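import Literature.NumberTheory.Automorphic.UnitaryCurveConeFrameTorus
import Literature.AlgebraicGeometry.ShimuraVarieties.UnitaryCurveConeSliceRegularity
import Mathlib.Analysis.Calculus.BumpFunction.InnerProduct
import HarnessLib

/-!
# A compactly supported smooth REPRODUCING KERNEL for cone-holomorphic cotangent-type functions on `U(σ_{w₁}J)(ℂ)` — rank 2,
# CHART-FREE (no disc model, no orbit push-forward formula, no `(𝔤, K)`-theory)

Topic `NumberTheory/Automorphic`; namespace `Literature.NumberTheory.Automorphic.UnitaryCurveForms`.  THEOREMS ONLY (no `def`, no instance, no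
notation, no named fact, no `sorry`); imports ★ `UnitaryCurveConeFrameTorus` (⇒ ★ `UnitaryCurveConeFrameCoordinates`), ★
`ShimuraVarieties/UnitaryCurveConeSliceRegularity` (A-p14 (g16): `isOpen_coneOpen`; ⇒ the rank-2 cone dictionary), Mathlib `ContDiffBump`.
Third of three files (F0P5-p01 (g2)); rank-3 twin over the BALL MODEL: ★ `UnitaryGroupHolCotFormsReproducing` (p03 (g2)).

THE THEOREM (`exists_coneReproducingKernel`).  For a cone frame `𝔣 = (v₀, t₀)` with `⟪v₀, t₀⟫ = 0` and ANY Haar measure `ν` on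
`U := U(σ_{w₁}J)(ℂ) ≤ GL₂(ℂ)` (Borel structure supplied by the caller) there is `A : M₂(ℂ) → ℂ`, `C^∞` on the cone-open
`Ω = {g | g invertible, g v₀ negative} ⊇ U` (read through `Matrix.of`, as clause 1 of ★ `IsConeHol`) and COMPACTLY SUPPORTED on `U`, such that for
EVERY `Φ` with ★ `IsConeHol 𝔣 Φ` (holomorphic on `Ω` with the cotangent law `Φ(g b) = (a k⁻¹) Φ(g)` along `Stab(ℂ v₀)`):
`u ↦ A(u) Φ(u)` is `ν`-integrable and `∫_U A(u) Φ(u) dν(u) = Φ(1)`.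
COROLLARIES: `holCotForms₂_slice_reproducing` (`∫_U A(u) f(y · adelicSingle w₁ u) dν(u) = f(y)` for `f ∈ holCotForms₂ … 𝔣`, every adelic `y`, ANY such `A`);
`exists_coneReproducingKernel_probe` — the kernel on `U` with the four `IsRegularKernel₁ γ` clauses of a (D)-road (continuous, compactly supported,
`C¹` along left probes `z ↦ A(γ z · u′)`, `γ z = exp (X z)`, jointly continuous probe derivative): the letter of stub (K₂) of the TP₂ sub-line.

PROOF.  In frame coordinates `h v₀ = y t₀ + x v₀`, `h t₀ = y′ t₀ + x′ v₀` the cone law gives `Φ(h) = ((x y′ − x′ y)∕x²) · F(y∕x)` with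
`F(ζ) = Φ(1 + ζ N)` holomorphic on the frame disc (★ `IsConeHol.apply_eq_factor_mul_apply_line`, `differentiableOn_line`); put
`A := α · x² ∕ (x y′ − x′ y) ∕ ∫ α dν` with `α = ψ(|y|² + |x|² + |y′|² + |x′|²)`, `ψ` a smooth bump at `2` (the value on `K_∞`), so that
`A · Φ = α · F(ζ) ∕ ∫ α` on `U`; `α` is invariant and `ζ` is ROTATED under left translation by the torus `K_∞` (★ `exists_frameTorus`,
`frameCoords_torus_mul`), hence `∫ α F(ζ) dν = F(0) ∫ α dν` by the rotation average (★ `integral_mul_eq_mul_integral_of_rotation`: left-invariance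
of `ν` + Fubini + Mathlib's one-variable `DiffContOnCl.circleAverage`), and `F(0) = Φ(1)`.  Positivity of `∫ α dν`: `α ≥ 0`, `α(1) = 1`, Haar charges
opens.  Compact support: ★ `isCompact_frameCoords_le`.  Borel (1997) §2.13–2.14, §5.14; Harish-Chandra (1966) §8 Thm. 1 (`φ = φ ∗ α`).  Cell
`hodgecm-mathlib`, floor 0, K-groundwork for the P5 named fact TP₂ (`Lines/F0_P5TP2SpectralProjection`, stub (K₂)); seat F0P5-p01 (g2).  HC_CM is
proved only modulo the printed citations until rung 0 closes; nothing printed is asserted here.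

## References
* [Borel1997] A. Borel, *Automorphic forms on SL₂(ℝ)*, Cambridge Tracts in Math. 130 (1997), §2.13–2.14 and §5.13–§5.14.
* [HarishChandra1966] Harish-Chandra, *Discrete series for semisimple Lie groups II*, Acta Math. 116 (1966), §8 Thm. 1.
* [Hall2015] B. Hall, *Lie Groups, Lie Algebras, and Representations*, 2nd ed., GTM 222 (2015), Prop. 2.3–2.4 (matrix exponential).
-/

set_option autoImplicit false

noncomputable section

open Matrix MeasureTheory NumberField NumberField.InfinitePlace
open scoped Matrix ComplexConjugate ComplexOrder ContDiff
open Literature.NumberTheory.Automorphic Literature.NumberTheory.Automorphic.UnitaryGroup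
open Literature.AlgebraicGeometry.ShimuraVarieties Literature.AlgebraicGeometry.ShimuraVarieties.UnitaryCurveCone

namespace Literature.NumberTheory.Automorphic.UnitaryCurveForms

variable {E : Type} [Field E] {J : Matrix (Fin 2) (Fin 2) E} {w₁ : {w : InfinitePlace E // IsComplex w}}
  {𝔣 : ConeFrame E J w₁}

/-! ## §1 THE REPRODUCING KERNEL -/

/-- **A compactly supported smooth REPRODUCING KERNEL for cone-holomorphic cotangent-type functions on `U(σ_{w₁}J)(ℂ)` — rank 2,
CHART-FREE.**  For `Jw = σ_{w₁}J` hermitian, a cone frame `𝔣 = (v₀, t₀)` and a Haar measure `ν` on `U = U(Jw) ≤ GL₂(ℂ)` (Borel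
structure supplied by the caller), there is `A : M₂(ℂ) → ℂ`, SMOOTH on the cone-open `Ω = {g | g invertible, g v₀ negative} ⊇ U` (read
through `Matrix.of`, as clause 1 of ★ `IsConeHol`) and COMPACTLY SUPPORTED on `U`, such that for EVERY cone-holomorphic `Φ` (★ `IsConeHol 𝔣 Φ`:
holomorphic on `Ω` with the cotangent law `Φ(g b) = (a k⁻¹) Φ(g)` along `Stab(ℂ v₀)`) the function `u ↦ A(u) Φ(u)` is `ν`-integrable and
`∫_U A(u) Φ(u) dν(u) = Φ(1)` — the MEAN-VALUE PROPERTY of holomorphic functions on the disc `U/K_∞` of negative lines, transported by the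
cotangent automorphy factor.  CONSTRUCTION: in frame coordinates `h v₀ = y t₀ + x v₀`, `h t₀ = y′ t₀ + x′ v₀` the cone law gives
`Φ(h) = ((x y′ − x′ y)∕x²) · F(y∕x)` with `F(ζ) = Φ(1 + ζ N)` holomorphic on the disc (§2–§3); `A := α · x² ∕ (x y′ − x′ y) ∕ ∫ α dν` with
`α = ψ(|x|² + |y|² + |x′|² + |y′|²)`, `ψ` a smooth bump at `2` (the value at `h ∈ K_∞`), so that `A Φ = α · F(ζ) ∕ ∫α` on `U`; `α` is invariant
and `ζ` is ROTATED under left translation by the torus `K_∞` (§4), so `∫ α F(ζ) dν = F(0) ∫ α dν` by the rotation average (§6) and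
`F(0) = Φ(1)`.  No disc model of `U(1,1)`, no push-forward of Haar measure and no `(𝔤, K)`-theory are used.  (Rank-3 twin over the ball
MODEL: ★ `UnitaryGroup.CotangentForms.stubK_reproducingKernel_holds`.) [cite: Borel1997, §2.13–2.14 and §5.13–§5.14]
[cite: HarishChandra1966, §8, Thm. 1] -/
theorem exists_coneReproducingKernel (𝔣 : ConeFrame E J w₁) (hvt : star 𝔣.v₀ ⬝ᵥ (J.map w₁.1.embedding *ᵥ 𝔣.t₀) = 0)
    [MeasurableSpace (archLocal E 2 J w₁)] [BorelSpace (archLocal E 2 J w₁)]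
    (ν : Measure (archLocal E 2 J w₁)) [ν.IsHaarMeasure] :
    ∃ A : Matrix (Fin 2) (Fin 2) ℂ → ℂ,
      ContDiffOn ℝ ∞ (fun g : Fin 2 → Fin 2 → ℂ => A (Matrix.of g))
          {g | IsUnit (Matrix.of g) ∧ Matrix.of g *ᵥ 𝔣.v₀ ∈ negCone (J.map w₁.1.embedding)} ∧
      HasCompactSupport (fun u : archLocal E 2 J w₁ => A ((u : GL (Fin 2) ℂ) : Matrix (Fin 2) (Fin 2) ℂ)) ∧
      ∀ Φ : Matrix (Fin 2) (Fin 2) ℂ → ℂ, IsConeHol 𝔣 Φ →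
        Integrable (fun u : archLocal E 2 J w₁ =>
          A ((u : GL (Fin 2) ℂ) : Matrix (Fin 2) (Fin 2) ℂ) * Φ ((u : GL (Fin 2) ℂ) : Matrix (Fin 2) (Fin 2) ℂ)) ν ∧
        ∫ u : archLocal E 2 J w₁,
          A ((u : GL (Fin 2) ℂ) : Matrix (Fin 2) (Fin 2) ℂ) * Φ ((u : GL (Fin 2) ℂ) : Matrix (Fin 2) (Fin 2) ℂ) ∂ν = Φ 1 := by
  classical
  obtain ⟨πt, πv, hdec⟩ := exists_frameFunctionals 𝔣 hvt
  obtain ⟨N, hNv, hNt, hNN⟩ := exists_frameNilpotent (𝔣 := 𝔣) hvt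
  have hfr := frameFunctionals_frame hvt hdec
  -- notation-free abbreviations for the frame coordinates of a matrix
  set x : Matrix (Fin 2) (Fin 2) ℂ → ℂ := fun M => πv (M *ᵥ 𝔣.v₀) with hxdef
  set y : Matrix (Fin 2) (Fin 2) ℂ → ℂ := fun M => πt (M *ᵥ 𝔣.v₀) with hydef
  set x' : Matrix (Fin 2) (Fin 2) ℂ → ℂ := fun M => πv (M *ᵥ 𝔣.t₀) with hx'def
  set y' : Matrix (Fin 2) (Fin 2) ℂ → ℂ := fun M => πt (M *ᵥ 𝔣.t₀) with hy'def
  set Sf : Matrix (Fin 2) (Fin 2) ℂ → ℝ := fun M => ‖y M‖ ^ 2 + ‖x M‖ ^ 2 + ‖y' M‖ ^ 2 + ‖x' M‖ ^ 2 with hSdef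
  let ψ : ContDiffBump (2 : ℝ) := ⟨1 / 4, 1 / 2, by norm_num, by norm_num⟩
  set α : Matrix (Fin 2) (Fin 2) ℂ → ℝ := fun M => ψ (Sf M) with hαdef
  set D : Matrix (Fin 2) (Fin 2) ℂ → ℂ := fun M => x M * y' M - x' M * y M with hDdef
  set A₀ : Matrix (Fin 2) (Fin 2) ℂ → ℂ := fun M => (α M : ℂ) * x M ^ 2 * (D M)⁻¹ with hA₀def
  -- the group, its coercion, and the restricted functions
  have hcoe : Continuous (fun u : archLocal E 2 J w₁ => ((u : GL (Fin 2) ℂ) : Matrix (Fin 2) (Fin 2) ℂ)) :=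
    (isClosedEmbedding_coe_archLocal (isUnit_form_of_orth hvt)).continuous
  have hxc : Continuous x := continuous_frameCoord πv 𝔣.v₀
  have hyc : Continuous y := continuous_frameCoord πt 𝔣.v₀
  have hx'c : Continuous x' := continuous_frameCoord πv 𝔣.t₀
  have hy'c : Continuous y' := continuous_frameCoord πt 𝔣.t₀
  have hSc : Continuous Sf := by
    simp only [hSdef]
    fun_prop
  have hαc : Continuous α := ψ.continuous.comp hSc
  set αU : archLocal E 2 J w₁ → ℝ := fun u => α ((u : GL (Fin 2) ℂ) : Matrix (Fin 2) (Fin 2) ℂ) with hαUdef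
  set ζU : archLocal E 2 J w₁ → ℂ := fun u =>
    y ((u : GL (Fin 2) ℂ) : Matrix (Fin 2) (Fin 2) ℂ) / x ((u : GL (Fin 2) ℂ) : Matrix (Fin 2) (Fin 2) ℂ) with hζUdef
  have hαUc : Continuous αU := hαc.comp hcoe
  -- negativity, non-vanishing of `x` and `D` on the group
  have hneg : ∀ u : archLocal E 2 J w₁,
      ((u : GL (Fin 2) ℂ) : Matrix (Fin 2) (Fin 2) ℂ) *ᵥ 𝔣.v₀ ∈ negCone (J.map w₁.1.embedding) :=
    fun u => (isUnit_and_mulVec_mem_negCone 𝔣 u).2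
  have hxU : ∀ u : archLocal E 2 J w₁, x ((u : GL (Fin 2) ℂ) : Matrix (Fin 2) (Fin 2) ℂ) ≠ 0 := fun u =>
    frameCoord_v₀_ne_zero_of_mem_negCone hvt hdec (hneg u)
  have hDU : ∀ u : archLocal E 2 J w₁, D ((u : GL (Fin 2) ℂ) : Matrix (Fin 2) (Fin 2) ℂ) ≠ 0 := fun u =>
    frameDet_ne_zero hvt hdec (isUnit_and_mulVec_mem_negCone 𝔣 u).1 (hxU u)
  have hζUc : Continuous ζU := (hyc.comp hcoe).div (hxc.comp hcoe) hxU
  -- compact support of `αU`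
  have hαU_zero : ∀ u : archLocal E 2 J w₁, ¬ Sf ((u : GL (Fin 2) ℂ) : Matrix (Fin 2) (Fin 2) ℂ) ≤ 3 → αU u = 0 := by
    intro u hu
    simp only [hαUdef, hαdef]
    refine ψ.zero_of_le_dist ?_
    rw [Real.dist_eq]
    have : (3 : ℝ) < Sf ((u : GL (Fin 2) ℂ) : Matrix (Fin 2) (Fin 2) ℂ) := lt_of_not_ge hu
    rw [abs_of_pos (by linarith)]
    norm_num
    linarith
  have hKc : IsCompact {u : archLocal E 2 J w₁ | Sf ((u : GL (Fin 2) ℂ) : Matrix (Fin 2) (Fin 2) ℂ) ≤ 3} := by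
    simpa only [hSdef] using isCompact_frameCoords_le hvt hdec (𝔣 := 𝔣) 3
  have hαUs : HasCompactSupport αU := HasCompactSupport.intro hKc (fun u hu => hαU_zero u hu)
  -- positivity of the normalising constant
  have hα_nonneg : ∀ u, 0 ≤ αU u := fun u => ψ.nonneg
  have hα_one : αU 1 = 1 := by
    simp only [hαUdef, hαdef]
    refine ψ.one_of_mem_closedBall ?_
    simp only [hSdef, hxdef, hydef, hx'def, hy'def, OneMemClass.coe_one, Units.val_one, one_mulVec, hfr.1, hfr.2.1,
      hfr.2.2.1, hfr.2.2.2, norm_zero, norm_one, Metric.mem_closedBall]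
    norm_num
  have hCpos : 0 < ∫ u, αU u ∂ν :=
    hαUc.integral_pos_of_hasCompactSupport_nonneg_nonzero hαUs hα_nonneg (by rw [hα_one]; exact one_ne_zero)
  set C : ℂ := ∫ u, (αU u : ℂ) ∂ν with hCdef
  have hCreal : C = ((∫ u, αU u ∂ν : ℝ) : ℂ) := integral_ofReal
  have hC0 : C ≠ 0 := by rw [hCreal]; exact_mod_cast hCpos.ne'
  -- the disc radius and holomorphy data
  set r₀ : ℝ := Real.sqrt (-(star 𝔣.v₀ ⬝ᵥ (J.map w₁.1.embedding *ᵥ 𝔣.v₀)).re /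
    (star 𝔣.t₀ ⬝ᵥ (J.map w₁.1.embedding *ᵥ 𝔣.t₀)).re) with hr₀
  have hζr : ∀ u : archLocal E 2 J w₁, ‖ζU u‖ < r₀ := by
    intro u
    rw [← mem_frameDisc_iff hvt]
    have : ζU u • 𝔣.t₀ + (1 : ℂ) • 𝔣.v₀ =
        (x ((u : GL (Fin 2) ℂ) : Matrix (Fin 2) (Fin 2) ℂ))⁻¹ • (((u : GL (Fin 2) ℂ) : Matrix (Fin 2) (Fin 2) ℂ) *ᵥ 𝔣.v₀) := by
      have hx0 := hxU u
      simp only [hζUdef, hxdef, hydef] at hx0 ⊢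
      have key : ∀ (w : Fin 2 → ℂ) (a d : ℂ), w = a • 𝔣.t₀ + d • 𝔣.v₀ → d ≠ 0 →
          (a / d) • 𝔣.t₀ + (1 : ℂ) • 𝔣.v₀ = d⁻¹ • w := by
        intro w a d hw hd
        rw [hw, smul_add, smul_smul, smul_smul, inv_mul_cancel₀ hd, div_eq_inv_mul]
      exact key _ _ _ (hdec _) hx0
    rw [this]
    exact smul_mem_negCone (inv_ne_zero (hxU u)) (hneg u)
  -- the torus
  have hrot : ∀ θ : ℝ, ∃ k : archLocal E 2 J w₁, (∀ u, αU (k * u) = αU u) ∧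
      ∀ u, ζU (k * u) = Complex.exp (θ * Complex.I) * ζU u := by
    intro θ
    have he : ‖Complex.exp (θ * Complex.I)‖ = 1 := Complex.norm_exp_ofReal_mul_I θ
    obtain ⟨k, hkv, hkt⟩ := exists_frameTorus (𝔣 := 𝔣) hvt he
    refine ⟨k, fun u => ?_, fun u => ?_⟩
    · have hv := frameCoords_torus_mul hvt hdec (M := ((u : GL (Fin 2) ℂ) : Matrix (Fin 2) (Fin 2) ℂ)) hkv hkt 𝔣.v₀
      have ht := frameCoords_torus_mul hvt hdec (M := ((u : GL (Fin 2) ℂ) : Matrix (Fin 2) (Fin 2) ℂ)) hkv hkt 𝔣.t₀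
      simp only [hαUdef, hαdef, hSdef, hxdef, hydef, hx'def, hy'def, Subgroup.coe_mul, Units.val_mul, hv.1, hv.2, ht.1,
        ht.2, norm_mul, he, one_mul]
    · have hv := frameCoords_torus_mul hvt hdec (M := ((u : GL (Fin 2) ℂ) : Matrix (Fin 2) (Fin 2) ℂ)) hkv hkt 𝔣.v₀
      simp only [hζUdef, hxdef, hydef, Subgroup.coe_mul, Units.val_mul, hv.1, hv.2, mul_div_assoc]
  -- THE KERNEL
  refine ⟨fun M => C⁻¹ * A₀ M, ?_, ?_, fun Φ hΦ => ?_⟩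
  · -- smoothness on the cone-open
    have hxs : ContDiff ℝ ∞ (fun g : Fin 2 → Fin 2 → ℂ => x (Matrix.of g)) := contDiff_frameCoord πv 𝔣.v₀
    have hys : ContDiff ℝ ∞ (fun g : Fin 2 → Fin 2 → ℂ => y (Matrix.of g)) := contDiff_frameCoord πt 𝔣.v₀
    have hx's : ContDiff ℝ ∞ (fun g : Fin 2 → Fin 2 → ℂ => x' (Matrix.of g)) := contDiff_frameCoord πv 𝔣.t₀
    have hy's : ContDiff ℝ ∞ (fun g : Fin 2 → Fin 2 → ℂ => y' (Matrix.of g)) := contDiff_frameCoord πt 𝔣.t₀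
    have hSs : ContDiff ℝ ∞ (fun g : Fin 2 → Fin 2 → ℂ => Sf (Matrix.of g)) := by
      simp only [hSdef]
      exact (((hys.norm_sq ℝ).add (hxs.norm_sq ℝ)).add (hy's.norm_sq ℝ)).add (hx's.norm_sq ℝ)
    have hαs : ContDiff ℝ ∞ (fun g : Fin 2 → Fin 2 → ℂ => (α (Matrix.of g) : ℂ)) := by
      simp only [hαdef]
      exact Complex.ofRealCLM.contDiff.comp (ψ.contDiff.comp hSs)
    have hDs : ContDiff ℝ ∞ (fun g : Fin 2 → Fin 2 → ℂ => D (Matrix.of g)) := by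
      simp only [hDdef]
      exact (hxs.mul hy's).sub (hx's.mul hys)
    have hDinv : ContDiffOn ℝ ∞ (fun g : Fin 2 → Fin 2 → ℂ => (D (Matrix.of g))⁻¹)
        {g | IsUnit (Matrix.of g) ∧ Matrix.of g *ᵥ 𝔣.v₀ ∈ negCone (J.map w₁.1.embedding)} := by
      refine hDs.contDiffOn.inv fun g hg => ?_
      exact frameDet_ne_zero hvt hdec hg.1 (frameCoord_v₀_ne_zero_of_mem_negCone hvt hdec hg.2)
    simp only [hA₀def]
    exact contDiffOn_const.mul (((hαs.mul (hxs.pow 2)).contDiffOn).mul hDinv)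
  · -- compact support on the group
    refine HasCompactSupport.intro hKc fun u hu => ?_
    have h0 : αU u = 0 := hαU_zero u hu
    simp only [hαUdef] at h0
    simp only [hA₀def, h0, Complex.ofReal_zero, zero_mul, mul_zero]
  · -- reproduction
    set F : ℂ → ℂ := fun ζ => Φ (1 + ζ • N) with hFdef
    have hF : DifferentiableOn ℂ F (Metric.ball 0 r₀) := by
      have h := hΦ.differentiableOn_line hNv hNN
      have hset : {ζ : ℂ | ζ • 𝔣.t₀ + (1 : ℂ) • 𝔣.v₀ ∈ negCone (J.map w₁.1.embedding)} = Metric.ball 0 r₀ := by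
        ext ζ
        rw [Set.mem_setOf_eq, mem_frameDisc_iff hvt, Metric.mem_ball, dist_zero_right]
      rw [hset] at h
      exact h
    -- pointwise identity on the group
    have hpt : ∀ u : archLocal E 2 J w₁,
        C⁻¹ * A₀ ((u : GL (Fin 2) ℂ) : Matrix (Fin 2) (Fin 2) ℂ) * Φ ((u : GL (Fin 2) ℂ) : Matrix (Fin 2) (Fin 2) ℂ) =
          C⁻¹ * ((αU u : ℂ) * F (ζU u)) := by
      intro u
      have hkey := hΦ.apply_eq_factor_mul_apply_line hvt hdec hNv hNt hNN (hneg u)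
      rw [hkey]
      simp only [hA₀def, hαUdef, hζUdef, hFdef, hxdef, hydef, hx'def, hy'def, hDdef]
      have hx0 := hxU u
      have hD0 := hDU u
      simp only [hxdef, hDdef, hx'def, hydef, hy'def] at hx0 hD0
      field_simp
    have hrotation := integral_mul_eq_mul_integral_of_rotation ν hαUc hαUs hζUc hζr hF hrot
    have hcont : Continuous fun u : archLocal E 2 J w₁ => C⁻¹ * ((αU u : ℂ) * F (ζU u)) := by
      refine continuous_const.mul ((Complex.continuous_ofReal.comp hαUc).mul ?_)
      exact hF.continuousOn.comp_continuous hζUc fun u => by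
        rw [Metric.mem_ball, dist_zero_right]; exact hζr u
    have hsupp : HasCompactSupport fun u : archLocal E 2 J w₁ => C⁻¹ * ((αU u : ℂ) * F (ζU u)) := by
      refine HasCompactSupport.intro hKc fun u hu => ?_
      rw [hαU_zero u hu, Complex.ofReal_zero, zero_mul, mul_zero]
    have hint : Integrable (fun u : archLocal E 2 J w₁ => C⁻¹ * ((αU u : ℂ) * F (ζU u))) ν :=
      hcont.integrable_of_hasCompactSupport hsupp
    have heq : (fun u : archLocal E 2 J w₁ =>
        C⁻¹ * A₀ ((u : GL (Fin 2) ℂ) : Matrix (Fin 2) (Fin 2) ℂ) * Φ ((u : GL (Fin 2) ℂ) : Matrix (Fin 2) (Fin 2) ℂ)) =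
        fun u => C⁻¹ * ((αU u : ℂ) * F (ζU u)) := funext hpt
    refine ⟨by rw [heq]; exact hint, ?_⟩
    rw [heq, integral_const_mul, hrotation, ← hCdef, ← mul_assoc, mul_comm C⁻¹, mul_assoc, inv_mul_cancel₀ hC0,
      mul_one, hFdef]
    simp only [zero_smul, add_zero]


/-! ## §2 The carriers' currency: holomorphic cotangent forms are reproduced along `adelicSingle w₁` -/

/-- **Holomorphic cotangent automorphic forms of `U(J)` (rank 2) are REPRODUCED along the archimedean factor at `w₁`** by ANY kernel `A` on
`U = U(σ_{w₁}J)(ℂ)` that reproduces cone-holomorphic functions at the identity (e.g. the kernel of `exists_coneReproducingKernel` ∕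
`exists_coneReproducingKernel_probe`): for `f ∈ holCotForms₂ … 𝔣` (★ `UnitaryCurveCohCotangentForms`) and every adelic base point `y`,
`u ↦ A(u) f(y · adelicSingle w₁ u)` is `ν`-integrable and `∫_U A(u) f(y · adelicSingle w₁ u) dν(u) = f(y)` — clause (H) of ★ `mem_holCotForms₂_iff`
says the `w₁`-slice through `y` is the restriction of a cone-holomorphic `Φ`, and `adelicSingle w₁ 1 = 1`.  (The `L²` form «`T_A [f] = [f]`» of a
rank-2 (D)-road's (S₂) stub is the image of this identity.) [cite: Borel1997, §2.13–2.14 and §5.14] [cite: HarishChandra1966, §8, Thm. 1] -/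
theorem holCotForms₂_slice_reproducing {F : Type} [Field F] [NumberField F] [NumberField E] [Algebra F E]
    (c : E ≃ₐ[F] E) (hc : c ≠ 1) (hfix : ∀ w : InfinitePlace E, c • w = w) (𝔣 : ConeFrame E J w₁)
    [MeasurableSpace (archLocal E 2 J w₁)] (ν : Measure (archLocal E 2 J w₁)) {A : archLocal E 2 J w₁ → ℂ}
    (hA : ∀ Φ : Matrix (Fin 2) (Fin 2) ℂ → ℂ, IsConeHol 𝔣 Φ →
      Integrable (fun u : archLocal E 2 J w₁ => A u * Φ ((u : GL (Fin 2) ℂ) : Matrix (Fin 2) (Fin 2) ℂ)) ν ∧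
      ∫ u : archLocal E 2 J w₁, A u * Φ ((u : GL (Fin 2) ℂ) : Matrix (Fin 2) (Fin 2) ℂ) ∂ν = Φ 1)
    {f : (adelicGroupData F E c 2 J).Adelic → ℂ} (hf : f ∈ holCotForms₂ F E c J hc hfix w₁ 𝔣) (y : (adelicGroupData F E c 2 J).Adelic) :
    Integrable (fun u : archLocal E 2 J w₁ => A u * f (y * adelicSingle F E c 2 J hc hfix w₁ u)) ν ∧
    ∫ u : archLocal E 2 J w₁, A u * f (y * adelicSingle F E c 2 J hc hfix w₁ u) ∂ν = f y := by
  obtain ⟨Φ, hΦ, hΦf⟩ := ((mem_holCotForms₂_iff F E c J hc hfix w₁ 𝔣 f).1 hf).2.2.2 y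
  have heq : (fun u : archLocal E 2 J w₁ => A u * f (y * adelicSingle F E c 2 J hc hfix w₁ u)) =
      fun u : archLocal E 2 J w₁ => A u * Φ ((u : GL (Fin 2) ℂ) : Matrix (Fin 2) (Fin 2) ℂ) :=
    funext fun u => by rw [hΦf u]
  obtain ⟨hint, hval⟩ := hA Φ hΦ
  refine ⟨heq ▸ hint, ?_⟩
  rw [heq, hval]
  have h1 := hΦf 1
  simp only [OneMemClass.coe_one, Units.val_one, map_one, mul_one] at h1
  exact h1

/-! ## §3 Probe regularity of a kernel smooth on the cone-open; the (K₂)-letter form -/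

section Probe

open scoped Matrix.Norms.Operator

/-- **LEFT-PROBE REGULARITY of a function smooth on the cone-open.**  If `Ã : M₂(ℂ) → ℂ` is `C^∞` on the cone-open `Ω ⊇ U` and
`γ : ℂ → U` is a matrix-exponential family `γ z = exp (X z)` (`X` real-linear), then on `U`: `u ↦ Ã u` is continuous, every left probe
`z ↦ Ã (γ z · u′)` is `C¹` on `ℂ`, and `(z, u′) ↦ ∂_z Ã(γ z · u′)` is jointly continuous — the regularity clauses of a rank-2 (D)-road's kernel
(`IsRegularKernel₁`), obtained by composing with the smooth map `(z, m) ↦ exp (X z) · m` into the open `Ω`. [cite: Borel1997, §2.13]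
[cite: Hall2015, Prop. 2.3–2.4] -/
theorem probeRegular_of_contDiffOn_coneOpen (𝔣 : ConeFrame E J w₁) {Ã : Matrix (Fin 2) (Fin 2) ℂ → ℂ}
    (hÃ : ContDiffOn ℝ ∞ (fun g : Fin 2 → Fin 2 → ℂ => Ã (Matrix.of g))
      {g | IsUnit (Matrix.of g) ∧ Matrix.of g *ᵥ 𝔣.v₀ ∈ negCone (J.map w₁.1.embedding)})
    (X : ℂ →ₗ[ℝ] Matrix (Fin 2) (Fin 2) ℂ) (γ : ℂ → archLocal E 2 J w₁)
    (hγ : ∀ z, ((γ z : GL (Fin 2) ℂ) : Matrix (Fin 2) (Fin 2) ℂ) = NormedSpace.exp (X z)) :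
    Continuous (fun u : archLocal E 2 J w₁ => Ã ((u : GL (Fin 2) ℂ) : Matrix (Fin 2) (Fin 2) ℂ)) ∧
    (∀ u' : archLocal E 2 J w₁, ContDiff ℝ 1 fun z : ℂ =>
        Ã (((γ z * u' : archLocal E 2 J w₁) : GL (Fin 2) ℂ) : Matrix (Fin 2) (Fin 2) ℂ)) ∧
    Continuous fun p : ℂ × archLocal E 2 J w₁ =>
      fderiv ℝ (fun z : ℂ => Ã (((γ z * p.2 : archLocal E 2 J w₁) : GL (Fin 2) ℂ) : Matrix (Fin 2) (Fin 2) ℂ)) p.1 := by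
  set Ω : Set (Fin 2 → Fin 2 → ℂ) :=
    {g | IsUnit (Matrix.of g) ∧ Matrix.of g *ᵥ 𝔣.v₀ ∈ negCone (J.map w₁.1.embedding)} with hΩ
  have hΩo : IsOpen Ω := isOpen_coneOpen 𝔣
  have hcoeM : Continuous fun u : archLocal E 2 J w₁ => (((u : GL (Fin 2) ℂ) : Matrix (Fin 2) (Fin 2) ℂ)) :=
    Units.continuous_val.comp continuous_subtype_val
  have hcoe : Continuous fun u : archLocal E 2 J w₁ =>
      Matrix.of.symm (((u : GL (Fin 2) ℂ) : Matrix (Fin 2) (Fin 2) ℂ)) := hcoeM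
  have hcoeΩ : ∀ u : archLocal E 2 J w₁, Matrix.of.symm (((u : GL (Fin 2) ℂ) : Matrix (Fin 2) (Fin 2) ℂ)) ∈ Ω :=
    fun u => ⟨(isUnit_and_mulVec_mem_negCone 𝔣 u).1, (isUnit_and_mulVec_mem_negCone 𝔣 u).2⟩
  set XL : ℂ →L[ℝ] Matrix (Fin 2) (Fin 2) ℂ := LinearMap.toContinuousLinearMap X with hXLdef
  set idL : Matrix (Fin 2) (Fin 2) ℂ →L[ℝ] (Fin 2 → Fin 2 → ℂ) :=
    LinearMap.toContinuousLinearMap (Matrix.ofLinearEquiv ℝ).symm.toLinearMap with hidLdef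
  set ofL : (Fin 2 → Fin 2 → ℂ) →L[ℝ] Matrix (Fin 2) (Fin 2) ℂ :=
    LinearMap.toContinuousLinearMap (Matrix.ofLinearEquiv ℝ).toLinearMap with hofLdef
  have hexp : ContDiff ℝ ∞ (NormedSpace.exp : Matrix (Fin 2) (Fin 2) ℂ → Matrix (Fin 2) (Fin 2) ℂ) :=
    contDiff_iff_contDiffAt.2 fun A => (NormedSpace.exp_analytic (𝕂 := ℝ) A).contDiffAt.of_le le_top
  -- the smooth two-variable map `(z, m) ↦ exp (X z) · m` and its pull-back of `Ω`
  set ψ : ℂ × (Fin 2 → Fin 2 → ℂ) → (Fin 2 → Fin 2 → ℂ) := fun p => idL (NormedSpace.exp (XL p.1) * ofL p.2) with hψdef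
  have hψ : ContDiff ℝ ∞ ψ :=
    idL.contDiff.comp ((hexp.comp (XL.contDiff.comp contDiff_fst)).mul (ofL.contDiff.comp contDiff_snd))
  set W : Set (ℂ × (Fin 2 → Fin 2 → ℂ)) := ψ ⁻¹' Ω with hW
  have hWo : IsOpen W := hΩo.preimage hψ.continuous
  have hΨ : ContDiffOn ℝ ∞ ((fun g : Fin 2 → Fin 2 → ℂ => Ã (Matrix.of g)) ∘ ψ) W :=
    hÃ.comp hψ.contDiffOn fun p hp => hp
  -- the probes factor through `ψ`
  have hfac : ∀ (u' : archLocal E 2 J w₁) (z : ℂ),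
      Ã (((γ z * u' : archLocal E 2 J w₁) : GL (Fin 2) ℂ) : Matrix (Fin 2) (Fin 2) ℂ) =
        ((fun g : Fin 2 → Fin 2 → ℂ => Ã (Matrix.of g)) ∘ ψ)
          (z, Matrix.of.symm (((u' : GL (Fin 2) ℂ) : Matrix (Fin 2) (Fin 2) ℂ))) := by
    intro u' z
    simp only [Function.comp_apply, hψdef, Subgroup.coe_mul, Units.val_mul, hγ]
    rfl
  have hmemW : ∀ (u' : archLocal E 2 J w₁) (z : ℂ),
      (z, Matrix.of.symm (((u' : GL (Fin 2) ℂ) : Matrix (Fin 2) (Fin 2) ℂ))) ∈ W := by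
    intro u' z
    have h := hcoeΩ (γ z * u')
    simp only [Subgroup.coe_mul, Units.val_mul, hγ] at h
    exact h
  have h1 : (1 : WithTop ℕ∞) ≤ ∞ := by exact_mod_cast le_top
  refine ⟨?_, fun u' => ?_, ?_⟩
  · exact hÃ.continuousOn.comp_continuous hcoe hcoeΩ
  · have hcurve : ContDiff ℝ ∞ fun z : ℂ => (z, Matrix.of.symm (((u' : GL (Fin 2) ℂ) : Matrix (Fin 2) (Fin 2) ℂ))) :=
      contDiff_id.prodMk contDiff_const
    have h := hΨ.comp_contDiff hcurve (fun z => hmemW u' z)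
    have hfun : (fun z : ℂ => Ã (((γ z * u' : archLocal E 2 J w₁) : GL (Fin 2) ℂ) : Matrix (Fin 2) (Fin 2) ℂ)) =
        ((fun g : Fin 2 → Fin 2 → ℂ => Ã (Matrix.of g)) ∘ ψ) ∘
          fun z : ℂ => (z, Matrix.of.symm (((u' : GL (Fin 2) ℂ) : Matrix (Fin 2) (Fin 2) ℂ))) := by
      funext z; exact hfac u' z
    rw [hfun]
    exact h.of_le h1
  · have hderiv : ∀ p : ℂ × archLocal E 2 J w₁,
        fderiv ℝ (fun z : ℂ => Ã (((γ z * p.2 : archLocal E 2 J w₁) : GL (Fin 2) ℂ) : Matrix (Fin 2) (Fin 2) ℂ)) p.1 =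
          (fderiv ℝ ((fun g : Fin 2 → Fin 2 → ℂ => Ã (Matrix.of g)) ∘ ψ)
              (p.1, Matrix.of.symm (((p.2 : GL (Fin 2) ℂ) : Matrix (Fin 2) (Fin 2) ℂ)))).comp
            (ContinuousLinearMap.inl ℝ ℂ (Fin 2 → Fin 2 → ℂ)) := by
      intro p
      have hfun : (fun z : ℂ => Ã (((γ z * p.2 : archLocal E 2 J w₁) : GL (Fin 2) ℂ) : Matrix (Fin 2) (Fin 2) ℂ)) =
          ((fun g : Fin 2 → Fin 2 → ℂ => Ã (Matrix.of g)) ∘ ψ) ∘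
            fun z : ℂ => (z, Matrix.of.symm (((p.2 : GL (Fin 2) ℂ) : Matrix (Fin 2) (Fin 2) ℂ))) := by
        funext z; exact hfac p.2 z
      rw [hfun]
      have hdiff : DifferentiableAt ℝ ((fun g : Fin 2 → Fin 2 → ℂ => Ã (Matrix.of g)) ∘ ψ)
          (p.1, Matrix.of.symm (((p.2 : GL (Fin 2) ℂ) : Matrix (Fin 2) (Fin 2) ℂ))) :=
        (hΨ.differentiableOn (by simp)).differentiableAt (hWo.mem_nhds (hmemW p.2 p.1))
      exact (hdiff.hasFDerivAt.comp p.1 (hasFDerivAt_prodMk_left p.1 _)).fderiv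
    have hcont : ContinuousOn (fderiv ℝ ((fun g : Fin 2 → Fin 2 → ℂ => Ã (Matrix.of g)) ∘ ψ)) W :=
      hΨ.continuousOn_fderiv_of_isOpen hWo h1
    have hpair : Continuous fun p : ℂ × archLocal E 2 J w₁ =>
        (p.1, Matrix.of.symm (((p.2 : GL (Fin 2) ℂ) : Matrix (Fin 2) (Fin 2) ℂ))) :=
      continuous_fst.prodMk (hcoe.comp continuous_snd)
    have h := (hcont.comp_continuous hpair fun p => hmemW p.2 p.1).clm_comp
      (continuous_const (y := ContinuousLinearMap.inl ℝ ℂ (Fin 2 → Fin 2 → ℂ)))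
    refine h.congr fun p => ?_
    exact (hderiv p).symm

end Probe

/-- **(K₂) IN THE LETTER OF A RANK-2 (D)-ROAD** — the reproducing kernel as a function on `U = U(σ_{w₁}J)(ℂ)` with the four regularity clauses
of `IsRegularKernel₁ γ` (continuous; compactly supported; `C¹` along the left probes `z ↦ A(γ z · u′)` of a matrix-exponential family
`γ z = exp (X z)`; jointly continuous probe derivative) and the reproduction `∫_U A(u) Φ(u) dν(u) = Φ(1)` for every cone-holomorphic `Φ`
(★ `IsConeHol 𝔣 Φ`).  Hypotheses: a cone frame with `⟪v₀, t₀⟫ = 0` (e.g. `σ_{w₁}J` hermitian, ★ `UnitaryCurveCone.form_v₀_t₀`), any real-linear `X`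
with an exponential family `γ` in `U`, any Haar measure `ν` (Borel structure supplied by the caller). [cite: Borel1997, §2.13–2.14 and §5.14]
[cite: HarishChandra1966, §8, Thm. 1] -/
theorem exists_coneReproducingKernel_probe (𝔣 : ConeFrame E J w₁) (hvt : star 𝔣.v₀ ⬝ᵥ (J.map w₁.1.embedding *ᵥ 𝔣.t₀) = 0)
    (X : ℂ →ₗ[ℝ] Matrix (Fin 2) (Fin 2) ℂ) (γ : ℂ → archLocal E 2 J w₁)
    (hγ : ∀ z, ((γ z : GL (Fin 2) ℂ) : Matrix (Fin 2) (Fin 2) ℂ) = NormedSpace.exp (X z))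
    [MeasurableSpace (archLocal E 2 J w₁)] [BorelSpace (archLocal E 2 J w₁)]
    (ν : Measure (archLocal E 2 J w₁)) [ν.IsHaarMeasure] :
    ∃ A : archLocal E 2 J w₁ → ℂ,
      (Continuous A ∧ HasCompactSupport A ∧ (∀ u' : archLocal E 2 J w₁, ContDiff ℝ 1 fun z : ℂ => A (γ z * u')) ∧
        Continuous fun p : ℂ × archLocal E 2 J w₁ => fderiv ℝ (fun z : ℂ => A (γ z * p.2)) p.1) ∧
      ∀ Φ : Matrix (Fin 2) (Fin 2) ℂ → ℂ, IsConeHol 𝔣 Φ →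
        Integrable (fun u : archLocal E 2 J w₁ => A u * Φ ((u : GL (Fin 2) ℂ) : Matrix (Fin 2) (Fin 2) ℂ)) ν ∧
        ∫ u : archLocal E 2 J w₁, A u * Φ ((u : GL (Fin 2) ℂ) : Matrix (Fin 2) (Fin 2) ℂ) ∂ν = Φ 1 := by
  obtain ⟨Ã, hÃ, hsupp, hrep⟩ := exists_coneReproducingKernel 𝔣 hvt ν
  obtain ⟨hc, hd, hcd⟩ := probeRegular_of_contDiffOn_coneOpen 𝔣 hÃ X γ hγ
  exact ⟨fun u => Ã ((u : GL (Fin 2) ℂ) : Matrix (Fin 2) (Fin 2) ℂ), ⟨hc, hsupp, hd, hcd⟩, hrep⟩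

end Literature.NumberTheory.Automorphic.UnitaryCurveForms

end
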